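import Literature.AlgebraicGeometry.Morphisms.SectionsFpqcDescentChart
import Literature.AlgebraicGeometry.Modules.EquivariantStructureRestrict
import HarnessLib

/-!
# The Γ-shadow of a descent datum on an affine chart of a torsor quotient IS an Amitsur datum (wave C organ (ii) Dγ-CHART)

Topic `Literature/AlgebraicGeometry/RelativeSpec`, namespace `Literature.AlgebraicGeometry.RelativeSpec.TorsorQuotient`.  THEOREMS ONLY; no
definition, no named fact, no instance, no notation, no `sorry`.

[MumfordAV1970] §12 Thm. 1 (B)(C) (p. 112) / [SGA1] Exp. VIII Thm. 1.1 / [StacksProject, Tag 023N] / [GortzWedhorn2020] Prop. 14.66, Thm. 14.68: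
a descent datum for a quasi-coherent module along an fppf torsor quotient `q : O → Q` — an isomorphism (here: any morphism)
`φ : act^* E ⟶ pr₂^* E` on the kernel pair `P ⇉ O` of `q` with unit and cocycle — READ ON ONE AFFINE CHART `V ⊆ Q` is exactly the ring-theoretic
Amitsur datum of ★ `RingTheory/Flat/ModuleDescentData` (row (ii)-alg): this file PRODUCES, from the scheme data, the rings, ring maps, modules,
semilinear maps and identities that file consumes (its «s7 binder block»), citing ★ `Morphisms/SectionsFpqcDescentChart` for every degree-one
fact (`Γ(V) → Γ(q⁻¹V)` faithfully flat; `Γ(W) = Γ(U) ⊗_{Γ(V)} Γ(U)`; the sections of `act^*E`, `pr₂^*E` over `W` are base changes of `Γ(U, E)`).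

CURRENCY (★ `RelativeSpec/TorsorQuotientDescent`): `S` a scheme, `P O Q : Over S`, `act pr₂ : P ⟶ O`, `q : O ⟶ Q`, the torsor square
`hsq : IsPullback act.left pr₂.left q.left q.left` (for a group-scheme action: `P = G ⊗ X`, `act = γ[G, X]`, `pr₂ = snd G X`, and `φ` = the `iso.hom` of
a `Linearisation`, ★ `Modules/SchemeLinearisation`).  THIS FILE = PART 1 (degree one): §1 the chart rings, §2 the two base changes, §3 the datum and the
first coface on the chart, §4 the BRIDGE identifying the chart equaliser condition with the invariance condition of ★
`RelativeSpec/SchemeEquivariantModuleInvariants` (the module of coinvariants `(π_* E)^G`).  The counit tokens (unit slice) are ★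
`RelativeSpec/TorsorQuotientModuleChartUnit`; the cocycle over the triple chart and the joint head are `RelativeSpec/TorsorQuotientModuleChartCocycle`
(PART 2).  Cell `hodgecm-mathlib`, P6b wave C; HC_CM is proved only modulo the printed citations until rung 0 closes; nothing here is about HC.

## References
* [MumfordAV1970] D. Mumford, *Abelian Varieties* (1970), §12 Thm. 1 (B)(C) (p. 112) and its proof.
* [SGA1] A. Grothendieck, *SGA 1*, Exp. VIII §1, Thm. 1.1.
* [StacksProject] The Stacks Project, Tags 023M, 023N.
* [GortzWedhorn2020] U. Görtz, T. Wedhorn, *Algebraic Geometry I*, 2nd ed. (2020), Prop. 14.66, Thm. 14.68.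
* [MumfordFogartyKirwan1994] D. Mumford, J. Fogarty, F. Kirwan, *Geometric Invariant Theory*, 3rd ed. (1994), Ch. 1 §3 Def. 1.6 (p. 30).
-/

noncomputable section

-- `TopCat.Presheaf`/`Scheme.Modules` are not reducible (as in Mathlib's `AlgebraicGeometry/Modules`).
set_option backward.isDefEq.respectTransparency false

universe u

open CategoryTheory CategoryTheory.Limits AlgebraicGeometry TopologicalSpace Opposite TensorProduct

namespace Literature.AlgebraicGeometry.RelativeSpec

namespace TorsorQuotient

open Literature.AlgebraicGeometry.Modules Literature.AlgebraicGeometry.Morphisms Literature.RingTheory.Flat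

variable {S : Scheme.{u}} {P O Q : Over S} (act pr₂ : P ⟶ O) (q : O ⟶ Q) (E : O.left.Modules)
  (φ : (Scheme.Modules.pullback act.left).obj E ⟶ (Scheme.Modules.pullback pr₂.left).obj E) {V : Q.left.Opens}

/-! ## §1 The chart rings: `Γ(V) → Γ(U)` faithfully flat; `Γ(W) = Γ(U) ⊗_{Γ(V)} Γ(U)` through `act♯`, `pr₂♯` (★ `Morphisms/SectionsFpqcDescentChart`) -/

/-- **`Γ(V) → Γ(q⁻¹V)` is faithfully flat** for `q.left` flat and surjective and `V`, `q⁻¹V` affine — ★ `Morphisms.faithfullyFlat_appLE`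
in the torsor currency. [cite: GortzWedhorn2020, Thm. 14.68] [cite: StacksProject, Tag 023M] -/
theorem faithfullyFlat_appLE_quotient [Flat q.left] [Surjective q.left] (hV : IsAffineOpen V)
    (hU : IsAffineOpen (q.left ⁻¹ᵁ V)) : (q.left.appLE V (q.left ⁻¹ᵁ V) le_rfl).hom.FaithfullyFlat :=
  faithfullyFlat_appLE q.left hV hU

/-- **`Γ(W) ≅ Γ(U) ⊗_{Γ(V)} Γ(U)` with `a ⊗ 1 ↦ act♯ a`, `1 ⊗ b ↦ pr₂♯ b`** (`U = q⁻¹V`, `W = act⁻¹U ⊓ pr₂⁻¹U`) — the TORSOR SQUARE read on the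
affine chart (★ `Morphisms.exists_ringEquiv_tensorProduct_kernelPair` at `g := q.left`, `p₁ := act.left`, `p₂ := pr₂.left`).
[cite: MumfordAV1970, §12 Thm. 1 (B) (p. 112)] [cite: StacksProject, Tag 023M] -/
theorem exists_ringEquiv_tensorProduct_chart (hsq : IsPullback act.left pr₂.left q.left q.left) (hV : IsAffineOpen V)
    (hU : IsAffineOpen (q.left ⁻¹ᵁ V)) :
    letI := (q.left.appLE V (q.left ⁻¹ᵁ V) le_rfl).hom.toAlgebra
    ∃ e : Γ(O.left, q.left ⁻¹ᵁ V) ⊗[Γ(Q.left, V)] Γ(O.left, q.left ⁻¹ᵁ V) ≃+*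
        Γ(P.left, act.left ⁻¹ᵁ (q.left ⁻¹ᵁ V) ⊓ pr₂.left ⁻¹ᵁ (q.left ⁻¹ᵁ V)),
      (∀ a, e (a ⊗ₜ 1) = act.left.appLE (q.left ⁻¹ᵁ V) (act.left ⁻¹ᵁ (q.left ⁻¹ᵁ V) ⊓ pr₂.left ⁻¹ᵁ (q.left ⁻¹ᵁ V)) inf_le_left a) ∧
      (∀ b, e (1 ⊗ₜ b) = pr₂.left.appLE (q.left ⁻¹ᵁ V) (act.left ⁻¹ᵁ (q.left ⁻¹ᵁ V) ⊓ pr₂.left ⁻¹ᵁ (q.left ⁻¹ᵁ V)) inf_le_right b) :=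
  exists_ringEquiv_tensorProduct_kernelPair q.left act.left pr₂.left hsq hV hU

/-- **`act♯ ∘ q♯ = pr₂♯ ∘ q♯` on `Γ(V)`**: both are `(act ≫ q)♯ = (pr₂ ≫ q)♯ : Γ(V) → Γ(W)` (the torsor square commutes); this is what makes
`act♯`, `pr₂♯` maps of `Γ(V)`-ALGEBRAS for the one `Γ(V)`-algebra structure on `Γ(W)`. [cite: MumfordAV1970, §12 Thm. 1 (B) (p. 112)] -/
theorem appLE_act_comp_appLE_eq (hw : act.left ≫ q.left = pr₂.left ≫ q.left) (r : Γ(Q.left, V)) :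
    act.left.appLE (q.left ⁻¹ᵁ V) (act.left ⁻¹ᵁ (q.left ⁻¹ᵁ V) ⊓ pr₂.left ⁻¹ᵁ (q.left ⁻¹ᵁ V)) inf_le_left
        (q.left.appLE V (q.left ⁻¹ᵁ V) le_rfl r) =
      pr₂.left.appLE (q.left ⁻¹ᵁ V) (act.left ⁻¹ᵁ (q.left ⁻¹ᵁ V) ⊓ pr₂.left ⁻¹ᵁ (q.left ⁻¹ᵁ V)) inf_le_right
        (q.left.appLE V (q.left ⁻¹ᵁ V) le_rfl r) := by
  change (q.left.appLE V (q.left ⁻¹ᵁ V) le_rfl ≫ act.left.appLE (q.left ⁻¹ᵁ V) _ inf_le_left) r =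
    (q.left.appLE V (q.left ⁻¹ᵁ V) le_rfl ≫ pr₂.left.appLE (q.left ⁻¹ᵁ V) _ inf_le_right) r
  rw [Scheme.Hom.appLE_comp_appLE, Scheme.Hom.appLE_comp_appLE]
  have h : (act.left ≫ q.left).appLE V (act.left ⁻¹ᵁ (q.left ⁻¹ᵁ V) ⊓ pr₂.left ⁻¹ᵁ (q.left ⁻¹ᵁ V))
      (inf_le_left.trans le_rfl : act.left ⁻¹ᵁ (q.left ⁻¹ᵁ V) ⊓ pr₂.left ⁻¹ᵁ (q.left ⁻¹ᵁ V) ≤ (act.left ≫ q.left) ⁻¹ᵁ V) =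
      (pr₂.left ≫ q.left).appLE V (act.left ⁻¹ᵁ (q.left ⁻¹ᵁ V) ⊓ pr₂.left ⁻¹ᵁ (q.left ⁻¹ᵁ V))
      (inf_le_right.trans le_rfl : act.left ⁻¹ᵁ (q.left ⁻¹ᵁ V) ⊓ pr₂.left ⁻¹ᵁ (q.left ⁻¹ᵁ V) ≤ (pr₂.left ≫ q.left) ⁻¹ᵁ V) := by
    have key : ∀ {f₁ f₂ : P.left ⟶ Q.left} (h : f₁ = f₂) (W : P.left.Opens) (e₁ : W ≤ f₁ ⁻¹ᵁ V) (e₂ : W ≤ f₂ ⁻¹ᵁ V),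
        f₁.appLE V W e₁ = f₂.appLE V W e₂ := by
      intro f₁ f₂ h W e₁ e₂; subst h; rfl
    exact key hw _ _ _
  exact congrArg (fun ψ => (ψ : Γ(Q.left, V) ⟶ _) r) h

/-! ## §2 The two base changes `j₁ = η_act|_W`, `j₂ = η_pr₂|_W` of `Γ(E, U)` to `Γ(W)` (★ `Modules/CechBaseChangeHom`) -/

/-- **`Γ(W, act^*E)` is the base change of `Γ(U, E)` along `act♯`**, structure map `j₁ : x ↦ η_act(x)|_W`
(★ `isBaseChange_unitSectionLE`). [cite: GortzWedhorn2020, Prop. 14.66] [cite: StacksProject, Tag 023N] -/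
theorem isBaseChange_act [E.IsQuasicoherent] (hU : IsAffineOpen (q.left ⁻¹ᵁ V))
    (hW : IsAffineOpen (act.left ⁻¹ᵁ (q.left ⁻¹ᵁ V) ⊓ pr₂.left ⁻¹ᵁ (q.left ⁻¹ᵁ V))) :
    letI := (act.left.appLE (q.left ⁻¹ᵁ V) (act.left ⁻¹ᵁ (q.left ⁻¹ᵁ V) ⊓ pr₂.left ⁻¹ᵁ (q.left ⁻¹ᵁ V)) inf_le_left).hom.toAlgebra
    letI : Module Γ(O.left, q.left ⁻¹ᵁ V)
        Γ((Scheme.Modules.pullback act.left).obj E, act.left ⁻¹ᵁ (q.left ⁻¹ᵁ V) ⊓ pr₂.left ⁻¹ᵁ (q.left ⁻¹ᵁ V)) :=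
      Module.compHom _ (act.left.appLE (q.left ⁻¹ᵁ V) (act.left ⁻¹ᵁ (q.left ⁻¹ᵁ V) ⊓ pr₂.left ⁻¹ᵁ (q.left ⁻¹ᵁ V)) inf_le_left).hom
    haveI : IsScalarTower Γ(O.left, q.left ⁻¹ᵁ V) Γ(P.left, act.left ⁻¹ᵁ (q.left ⁻¹ᵁ V) ⊓ pr₂.left ⁻¹ᵁ (q.left ⁻¹ᵁ V))
        Γ((Scheme.Modules.pullback act.left).obj E, act.left ⁻¹ᵁ (q.left ⁻¹ᵁ V) ⊓ pr₂.left ⁻¹ᵁ (q.left ⁻¹ᵁ V)) :=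
      ⟨fun a b x => mul_smul ((act.left.appLE (q.left ⁻¹ᵁ V) (act.left ⁻¹ᵁ (q.left ⁻¹ᵁ V) ⊓ pr₂.left ⁻¹ᵁ (q.left ⁻¹ᵁ V))
        inf_le_left).hom a) b x⟩
    IsBaseChange Γ(P.left, act.left ⁻¹ᵁ (q.left ⁻¹ᵁ V) ⊓ pr₂.left ⁻¹ᵁ (q.left ⁻¹ᵁ V))
      (unitSectionLEₗ act.left E (inf_le_left : act.left ⁻¹ᵁ (q.left ⁻¹ᵁ V) ⊓ pr₂.left ⁻¹ᵁ (q.left ⁻¹ᵁ V) ≤ _)) :=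
  isBaseChange_unitSectionLE act.left E _ hU hW (IsAffineLocalizing.of_isQuasicoherent E)

/-- **`Γ(W, pr₂^*E)` is the base change of `Γ(U, E)` along `pr₂♯`**, structure map `j₂ : x ↦ η_pr₂(x)|_W`
(★ `isBaseChange_unitSectionLE`). [cite: GortzWedhorn2020, Prop. 14.66] [cite: StacksProject, Tag 023N] -/
theorem isBaseChange_snd [E.IsQuasicoherent] (hU : IsAffineOpen (q.left ⁻¹ᵁ V))
    (hW : IsAffineOpen (act.left ⁻¹ᵁ (q.left ⁻¹ᵁ V) ⊓ pr₂.left ⁻¹ᵁ (q.left ⁻¹ᵁ V))) :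
    letI := (pr₂.left.appLE (q.left ⁻¹ᵁ V) (act.left ⁻¹ᵁ (q.left ⁻¹ᵁ V) ⊓ pr₂.left ⁻¹ᵁ (q.left ⁻¹ᵁ V)) inf_le_right).hom.toAlgebra
    letI : Module Γ(O.left, q.left ⁻¹ᵁ V)
        Γ((Scheme.Modules.pullback pr₂.left).obj E, act.left ⁻¹ᵁ (q.left ⁻¹ᵁ V) ⊓ pr₂.left ⁻¹ᵁ (q.left ⁻¹ᵁ V)) :=
      Module.compHom _ (pr₂.left.appLE (q.left ⁻¹ᵁ V) (act.left ⁻¹ᵁ (q.left ⁻¹ᵁ V) ⊓ pr₂.left ⁻¹ᵁ (q.left ⁻¹ᵁ V)) inf_le_right).hom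
    haveI : IsScalarTower Γ(O.left, q.left ⁻¹ᵁ V) Γ(P.left, act.left ⁻¹ᵁ (q.left ⁻¹ᵁ V) ⊓ pr₂.left ⁻¹ᵁ (q.left ⁻¹ᵁ V))
        Γ((Scheme.Modules.pullback pr₂.left).obj E, act.left ⁻¹ᵁ (q.left ⁻¹ᵁ V) ⊓ pr₂.left ⁻¹ᵁ (q.left ⁻¹ᵁ V)) :=
      ⟨fun a b x => mul_smul ((pr₂.left.appLE (q.left ⁻¹ᵁ V) (act.left ⁻¹ᵁ (q.left ⁻¹ᵁ V) ⊓ pr₂.left ⁻¹ᵁ (q.left ⁻¹ᵁ V))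
        inf_le_right).hom a) b x⟩
    IsBaseChange Γ(P.left, act.left ⁻¹ᵁ (q.left ⁻¹ᵁ V) ⊓ pr₂.left ⁻¹ᵁ (q.left ⁻¹ᵁ V))
      (unitSectionLEₗ pr₂.left E (inf_le_right : act.left ⁻¹ᵁ (q.left ⁻¹ᵁ V) ⊓ pr₂.left ⁻¹ᵁ (q.left ⁻¹ᵁ V) ≤ _)) :=
  isBaseChange_unitSectionLE pr₂.left E _ hU hW (IsAffineLocalizing.of_isQuasicoherent E)

/-- `j₁` is `act♯`-semilinear: `η_act(c • x)|_W = act♯ c • η_act(x)|_W` (★ `unitSectionLE_smul`). [cite: GortzWedhorn2020, Prop. 14.66] -/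
theorem unitSectionLE_act_smul (c : Γ(O.left, q.left ⁻¹ᵁ V)) (x : Γ(E, q.left ⁻¹ᵁ V)) :
    unitSectionLE act.left E (inf_le_left : act.left ⁻¹ᵁ (q.left ⁻¹ᵁ V) ⊓ pr₂.left ⁻¹ᵁ (q.left ⁻¹ᵁ V) ≤ _) (c • x) =
      act.left.appLE (q.left ⁻¹ᵁ V) (act.left ⁻¹ᵁ (q.left ⁻¹ᵁ V) ⊓ pr₂.left ⁻¹ᵁ (q.left ⁻¹ᵁ V)) inf_le_left c •
        unitSectionLE act.left E (inf_le_left : act.left ⁻¹ᵁ (q.left ⁻¹ᵁ V) ⊓ pr₂.left ⁻¹ᵁ (q.left ⁻¹ᵁ V) ≤ _) x :=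
  unitSectionLE_smul act.left E _ c x

/-- `j₂` is `pr₂♯`-semilinear: `η_pr₂(c • x)|_W = pr₂♯ c • η_pr₂(x)|_W` (★ `unitSectionLE_smul`). [cite: GortzWedhorn2020, Prop. 14.66] -/
theorem unitSectionLE_snd_smul (c : Γ(O.left, q.left ⁻¹ᵁ V)) (x : Γ(E, q.left ⁻¹ᵁ V)) :
    unitSectionLE pr₂.left E (inf_le_right : act.left ⁻¹ᵁ (q.left ⁻¹ᵁ V) ⊓ pr₂.left ⁻¹ᵁ (q.left ⁻¹ᵁ V) ≤ _) (c • x) =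
      pr₂.left.appLE (q.left ⁻¹ᵁ V) (act.left ⁻¹ᵁ (q.left ⁻¹ᵁ V) ⊓ pr₂.left ⁻¹ᵁ (q.left ⁻¹ᵁ V)) inf_le_right c •
        unitSectionLE pr₂.left E (inf_le_right : act.left ⁻¹ᵁ (q.left ⁻¹ᵁ V) ⊓ pr₂.left ⁻¹ᵁ (q.left ⁻¹ᵁ V) ≤ _) x :=
  unitSectionLE_smul pr₂.left E _ c x

/-! ## §3 The datum on the chart: `Φ := φ.app W` is `Γ(W)`-linear; the coface `δ₁ := Φ ∘ j₁` is `act♯`-semilinear -/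

/-- **`Φ := φ.app W` is `Γ(W)`-linear** (components of a morphism of `𝒪`-modules). [cite: GortzWedhorn2020, Prop. 14.66] -/
theorem app_smul_chart (W : P.left.Opens) (c : Γ(P.left, W)) (x : Γ((Scheme.Modules.pullback act.left).obj E, W)) :
    φ.app W (c • x) = c • φ.app W x :=
  Scheme.Modules.Hom.app_smul _ _ _

/-- The first coface `δ₁ x := Φ (η_act(x)|_W)` is `act♯`-semilinear. [cite: GortzWedhorn2020, Prop. 14.66] [cite: StacksProject, Tag 023N] -/
theorem cofaceAct_smul (c : Γ(O.left, q.left ⁻¹ᵁ V)) (x : Γ(E, q.left ⁻¹ᵁ V)) :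
    φ.app _ (unitSectionLE act.left E (inf_le_left : act.left ⁻¹ᵁ (q.left ⁻¹ᵁ V) ⊓ pr₂.left ⁻¹ᵁ (q.left ⁻¹ᵁ V) ≤ _) (c • x)) =
      act.left.appLE (q.left ⁻¹ᵁ V) (act.left ⁻¹ᵁ (q.left ⁻¹ᵁ V) ⊓ pr₂.left ⁻¹ᵁ (q.left ⁻¹ᵁ V)) inf_le_left c •
        φ.app _ (unitSectionLE act.left E (inf_le_left : act.left ⁻¹ᵁ (q.left ⁻¹ᵁ V) ⊓ pr₂.left ⁻¹ᵁ (q.left ⁻¹ᵁ V) ≤ _) x) := by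
  rw [unitSectionLE_smul, Scheme.Modules.Hom.app_smul]

/-! ## §4 The `W`-BRIDGE (seam s18∕s8): `act⁻¹U = pr₂⁻¹U`, and the chart equaliser condition `Φ (j₁ s) = j₂ s` on `W = act⁻¹U ⊓ pr₂⁻¹U`
is the invariance condition of ★ `SchemeEquivariant.mem_range_moduleCoinvariantsι_app_iff` (stated on `act⁻¹U`, transported to `pr₂⁻¹U`) -/

section Bridge

variable (hw : act.left ≫ q.left = pr₂.left ≫ q.left)

include hw in
/-- **`act⁻¹(q⁻¹V) = pr₂⁻¹(q⁻¹V)`** (`act ≫ q = pr₂ ≫ q`; ★ (i) `SchemeEquivariant.preimage_preimage_eq` in the torsor currency).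
[cite: MumfordAV1970, §12 proof of Thm. 1 (p. 112)] -/
theorem preimage_act_eq_preimage_snd : act.left ⁻¹ᵁ (q.left ⁻¹ᵁ V) = pr₂.left ⁻¹ᵁ (q.left ⁻¹ᵁ V) := by
  rw [← Scheme.Hom.comp_preimage, ← Scheme.Hom.comp_preimage, hw]

include hw in
/-- `pr₂⁻¹U ≤ W` (so `W = pr₂⁻¹U = act⁻¹U`). [cite: MumfordAV1970, §12 proof of Thm. 1 (p. 112)] -/
theorem preimage_snd_le_inf : pr₂.left ⁻¹ᵁ (q.left ⁻¹ᵁ V) ≤ act.left ⁻¹ᵁ (q.left ⁻¹ᵁ V) ⊓ pr₂.left ⁻¹ᵁ (q.left ⁻¹ᵁ V) :=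
  le_inf (preimage_act_eq_preimage_snd act pr₂ q hw).ge le_rfl

/-- **THE BRIDGE (s18 = s8 on the chart)**: for `s ∈ Γ(E, U)`, the chart equaliser condition `Φ (η_act(s)|_W) = η_pr₂(s)|_W` in `Γ(W, pr₂^*E)`
holds IFF the invariance condition of ★ `SchemeEquivariant.mem_range_moduleCoinvariantsι_app_iff` holds — `φ(η_act s)`, transported along
`act⁻¹U = pr₂⁻¹U`, equals `η_pr₂ s` in `Γ(pr₂⁻¹U, pr₂^*E)`.  (Restriction from `pr₂⁻¹U` to `W = pr₂⁻¹U` is injective; the transport followed by the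
restriction to `W` is the restriction `act⁻¹U → W`.)  Hence (iii)'s `N_V := Γ((π_* E)^G, V)` is EXACTLY the `range j` of (ii)-alg's head.
[cite: MumfordAV1970, §12 proof of Thm. 1 (p. 112)] [cite: StacksProject, Tag 023N] -/
theorem app_unitSectionLE_eq_iff (s : Γ(E, q.left ⁻¹ᵁ V)) :
    φ.app _ (unitSectionLE act.left E (inf_le_left : act.left ⁻¹ᵁ (q.left ⁻¹ᵁ V) ⊓ pr₂.left ⁻¹ᵁ (q.left ⁻¹ᵁ V) ≤ _) s) =
        unitSectionLE pr₂.left E (inf_le_right : act.left ⁻¹ᵁ (q.left ⁻¹ᵁ V) ⊓ pr₂.left ⁻¹ᵁ (q.left ⁻¹ᵁ V) ≤ _) s ↔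
      ((Scheme.Modules.pullback pr₂.left).obj E).presheaf.map
          (eqToHom (preimage_act_eq_preimage_snd act pr₂ q hw (V := V)).symm).op
          (φ.app (act.left ⁻¹ᵁ (q.left ⁻¹ᵁ V)) (unitSection act.left E (q.left ⁻¹ᵁ V) s)) =
        unitSection pr₂.left E (q.left ⁻¹ᵁ V) s := by
  -- both sides of the chart condition are RESTRICTIONS to `W = pr₂⁻¹U` of the two sides of the invariance condition
  have hcomb : ∀ z : Γ((Scheme.Modules.pullback pr₂.left).obj E, act.left ⁻¹ᵁ (q.left ⁻¹ᵁ V)),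
      ((Scheme.Modules.pullback pr₂.left).obj E).presheaf.map
          (homOfLE (inf_le_right : act.left ⁻¹ᵁ (q.left ⁻¹ᵁ V) ⊓ pr₂.left ⁻¹ᵁ (q.left ⁻¹ᵁ V) ≤ pr₂.left ⁻¹ᵁ (q.left ⁻¹ᵁ V))).op
          (((Scheme.Modules.pullback pr₂.left).obj E).presheaf.map
            (eqToHom (preimage_act_eq_preimage_snd act pr₂ q hw (V := V)).symm).op z) =
        ((Scheme.Modules.pullback pr₂.left).obj E).presheaf.map
          (homOfLE (inf_le_left : act.left ⁻¹ᵁ (q.left ⁻¹ᵁ V) ⊓ pr₂.left ⁻¹ᵁ (q.left ⁻¹ᵁ V) ≤ act.left ⁻¹ᵁ (q.left ⁻¹ᵁ V))).op z := by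
    intro z
    erw [← CategoryTheory.comp_apply, ← Functor.map_comp, ← op_comp]
    exact presheaf_map_congr _ _ _ _
  have hL : φ.app _ (unitSectionLE act.left E (inf_le_left : act.left ⁻¹ᵁ (q.left ⁻¹ᵁ V) ⊓ pr₂.left ⁻¹ᵁ (q.left ⁻¹ᵁ V) ≤ _) s) =
      ((Scheme.Modules.pullback pr₂.left).obj E).presheaf.map
        (homOfLE (inf_le_right : act.left ⁻¹ᵁ (q.left ⁻¹ᵁ V) ⊓ pr₂.left ⁻¹ᵁ (q.left ⁻¹ᵁ V) ≤ pr₂.left ⁻¹ᵁ (q.left ⁻¹ᵁ V))).op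
        (((Scheme.Modules.pullback pr₂.left).obj E).presheaf.map
          (eqToHom (preimage_act_eq_preimage_snd act pr₂ q hw (V := V)).symm).op
          (φ.app (act.left ⁻¹ᵁ (q.left ⁻¹ᵁ V)) (unitSection act.left E (q.left ⁻¹ᵁ V) s))) := by
    rw [hcomb, unitSectionLE]
    erw [app_presheaf_map]
  -- the restriction `Γ(pr₂⁻¹U) → Γ(W)` is injective (`W = pr₂⁻¹U`)
  have inj : ∀ x y : Γ((Scheme.Modules.pullback pr₂.left).obj E, pr₂.left ⁻¹ᵁ (q.left ⁻¹ᵁ V)),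
      ((Scheme.Modules.pullback pr₂.left).obj E).presheaf.map
          (homOfLE (inf_le_right : act.left ⁻¹ᵁ (q.left ⁻¹ᵁ V) ⊓ pr₂.left ⁻¹ᵁ (q.left ⁻¹ᵁ V) ≤ pr₂.left ⁻¹ᵁ (q.left ⁻¹ᵁ V))).op x =
        ((Scheme.Modules.pullback pr₂.left).obj E).presheaf.map
          (homOfLE (inf_le_right : act.left ⁻¹ᵁ (q.left ⁻¹ᵁ V) ⊓ pr₂.left ⁻¹ᵁ (q.left ⁻¹ᵁ V) ≤ pr₂.left ⁻¹ᵁ (q.left ⁻¹ᵁ V))).op y →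
      x = y := by
    intro x y hxy
    have back : ∀ z : Γ((Scheme.Modules.pullback pr₂.left).obj E, pr₂.left ⁻¹ᵁ (q.left ⁻¹ᵁ V)),
        ((Scheme.Modules.pullback pr₂.left).obj E).presheaf.map (homOfLE (preimage_snd_le_inf act pr₂ q hw (V := V))).op
          (((Scheme.Modules.pullback pr₂.left).obj E).presheaf.map
            (homOfLE (inf_le_right : act.left ⁻¹ᵁ (q.left ⁻¹ᵁ V) ⊓ pr₂.left ⁻¹ᵁ (q.left ⁻¹ᵁ V) ≤ pr₂.left ⁻¹ᵁ (q.left ⁻¹ᵁ V))).op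
            z) = z := by
      intro z
      erw [← CategoryTheory.comp_apply, ← Functor.map_comp, ← op_comp]
      exact (presheaf_map_congr _ _ (𝟙 _) z).trans (by rw [op_id, CategoryTheory.Functor.map_id]; rfl)
    rw [← back x, ← back y, hxy]
  rw [hL, unitSectionLE]
  constructor
  · exact fun h => inj _ _ h
  · intro h
    rw [h]

end Bridge

end TorsorQuotient

end Literature.AlgebraicGeometry.RelativeSpec

end
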